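import Mathlib.Analysis.Normed.Module.FiniteDimension
import Mathlib.Analysis.SpecialFunctions.Pow.Real
import Mathlib.Topology.MetricSpace.ProperSpace
import HarnessLib

/-!
# Maximising a superadditive positively homogeneous function on the unit sphere of a closed cone
# (the convexity step of Kempf 1978, Thm. 2.2)

Kempf's theorem on optimal one-parameter subgroups (G. R. Kempf, *Instability in invariant theory*,
Ann. of Math. 108 (1978), Thm. 2.2) rests on an elementary fact about the real vector space
`X_*(T) ⊗ ℝ ≅ ℝ^σ` with a `W`-invariant Euclidean norm: a function which is the minimum of finitely
many linear forms (more generally: superadditive and positively homogeneous), restricted to the unit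
vectors of a closed convex cone on which it takes a positive value, ATTAINS its maximum (compactness)
and attains it at a UNIQUE point (two distinct unit maximisers have a midpoint of norm `< 1` where
the function is at least as large; rescaling to the sphere strictly increases a positive value).

This file proves exactly these two statements for `ℝ^σ = σ → ℝ` with the Euclidean quadratic form
written out as `∑ i, a i ^ 2` (no new definitions):

* `exists_max_on_cone_sphere` — existence of a maximiser of a continuous `F` on
  `{a ∈ C | ∑ a_i² = 1}` for a closed `C ⊆ ℝ^σ` meeting the sphere;
* `eq_of_max_on_cone_sphere` — uniqueness of the maximiser when `C` is closed under addition and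
  positive scaling, `F` is superadditive and positively homogeneous, and the maximum is `> 0`.

THEOREMS ONLY (Mathlib-only; no definitions, no named facts). Used by
`Computability/AlgebraicComplexity/KempfOptimalParabolicSL.lean` (Kempf's numerical function
`a ↦ M(u,a)` is a minimum of finitely many linear forms in `a`). Honest framing: textbook convex
analysis; cell `val-lit`, seat t14 g7.

## References

* [Kempf1978] G. R. Kempf, *Instability in invariant theory*, Ann. of Math. (2) 108 (1978), §2,
  Thm. 2.2 and its proof (existence and uniqueness of the point of `|X,x|` maximising
  `m(x,λ)/‖λ‖`), cite-only.
* [MumfordFogartyKirwan1994] D. Mumford, J. Fogarty, F. Kirwan, *Geometric Invariant Theory*,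
  3rd ed., Ch. 2 §2 (the function `ν` on the flag complex, convexity), held
  (`book:mumford1994-geometric-invariant-theory`).
-/

noncomputable section

open scoped BigOperators

namespace Literature.Analysis.Convex

variable {σ : Type} [Fintype σ]

/-- The Euclidean unit sphere `{a : ∑ a_i² = 1}` of `ℝ^σ` lies in the sup-norm unit ball.
[cite: Kempf1978, §2 (the norm on `X_*(T) ⊗ ℝ`)] -/
theorem norm_le_one_of_sum_sq_eq_one {a : σ → ℝ} (ha : ∑ i, a i ^ 2 = 1) : ‖a‖ ≤ 1 := by
  refine (pi_norm_le_iff_of_nonneg zero_le_one).mpr fun i => ?_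
  rw [Real.norm_eq_abs, ← sq_le_one_iff_abs_le_one]
  calc a i ^ 2 ≤ ∑ j, a j ^ 2 :=
        Finset.single_le_sum (f := fun j => a j ^ 2) (fun j _ => sq_nonneg (a j)) (Finset.mem_univ i)
    _ = 1 := ha

/-- The quadratic form `a ↦ ∑ a_i²` is continuous on `ℝ^σ`. [cite: Kempf1978, §2 (the norm on `X_*(T) ⊗ ℝ`)] -/
theorem continuous_sum_sq : Continuous fun a : σ → ℝ => ∑ i, a i ^ 2 :=
  continuous_finsetSum _ fun i _ => (continuous_apply i).pow 2

/-- **Existence of an optimal unit vector** (the compactness half of Kempf's Thm. 2.2): a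
continuous function attains its maximum on the unit vectors of a closed subset `C ⊆ ℝ^σ` meeting
the unit sphere. [cite: Kempf1978, Thm. 2.2 (proof: existence)] -/
theorem exists_max_on_cone_sphere {C : Set (σ → ℝ)} (hC : IsClosed C) {F : (σ → ℝ) → ℝ}
    (hF : Continuous F) (hne : ∃ a ∈ C, ∑ i, a i ^ 2 = 1) :
    ∃ a ∈ C, ∑ i, a i ^ 2 = 1 ∧ ∀ b ∈ C, ∑ i, b i ^ 2 = 1 → F b ≤ F a := by
  set A : Set (σ → ℝ) := C ∩ {a | ∑ i, a i ^ 2 = 1} with hA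
  have hAc : IsCompact A := by
    apply Metric.isCompact_of_isClosed_isBounded
    · exact hC.inter (isClosed_eq continuous_sum_sq continuous_const)
    · refine (Metric.isBounded_closedBall (x := (0 : σ → ℝ)) (r := 1)).subset fun a ha => ?_
      rw [Metric.mem_closedBall, dist_zero_right]
      exact norm_le_one_of_sum_sq_eq_one ha.2
  obtain ⟨a₀, ha₀, h1⟩ := hne
  obtain ⟨a, haA, hmax⟩ := hAc.exists_isMaxOn ⟨a₀, ha₀, h1⟩ hF.continuousOn
  exact ⟨a, haA.1, haA.2, fun b hb hb1 => hmax ⟨hb, hb1⟩⟩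

/-- The parallelogram computation: for Euclidean unit vectors `a ≠ a'`, the midpoint has
`∑ ((a_i + a'_i)/2)² < 1`. [cite: Kempf1978, Thm. 2.2 (proof: uniqueness, convexity of the norm)] -/
theorem sum_sq_midpoint_lt_one {a a' : σ → ℝ} (ha : ∑ i, a i ^ 2 = 1) (ha' : ∑ i, a' i ^ 2 = 1)
    (hne : a ≠ a') : ∑ i, ((1 / 2 : ℝ) • (a + a')) i ^ 2 < 1 := by
  obtain ⟨i₀, hi₀⟩ := Function.ne_iff.mp hne
  have hpos : 0 < ∑ i, (a i - a' i) ^ 2 :=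
    lt_of_lt_of_le (by positivity : 0 < (a i₀ - a' i₀) ^ 2)
      (Finset.single_le_sum (f := fun i => (a i - a' i) ^ 2) (fun i _ => sq_nonneg _)
        (Finset.mem_univ i₀))
  have hid : ∑ i, ((1 / 2 : ℝ) • (a + a')) i ^ 2 =
      (2 * ∑ i, a i ^ 2 + 2 * ∑ i, a' i ^ 2 - ∑ i, (a i - a' i) ^ 2) / 4 := by
    rw [Finset.mul_sum, Finset.mul_sum, ← Finset.sum_add_distrib, ← Finset.sum_sub_distrib,
      eq_div_iff (by norm_num : (4 : ℝ) ≠ 0), Finset.sum_mul]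
    refine Finset.sum_congr rfl fun i _ => ?_
    simp only [Pi.smul_apply, Pi.add_apply, smul_eq_mul]
    ring
  rw [hid, ha, ha']
  linarith

omit [Fintype σ] in
/-- A positively homogeneous function vanishes at `0`. [cite: Kempf1978, §2] -/
theorem eq_zero_of_posHom {F : (σ → ℝ) → ℝ} (hFhom : ∀ t : ℝ, 0 < t → ∀ a, F (t • a) = t * F a) :
    F 0 = 0 := by
  have h := hFhom 2 two_pos 0
  rw [smul_zero] at h
  linarith

/-- **Uniqueness of the optimal unit vector** (the convexity half of Kempf's Thm. 2.2): let
`C ⊆ ℝ^σ` be closed under addition and positive scaling, `F` superadditive and positively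
homogeneous, and let `ν > 0` bound `F` on the unit vectors of `C`. Then at most one unit vector of
`C` achieves `F = ν`. [cite: Kempf1978, Thm. 2.2 (proof: uniqueness)] -/
theorem eq_of_max_on_cone_sphere {C : Set (σ → ℝ)} (hadd : ∀ a ∈ C, ∀ b ∈ C, a + b ∈ C)
    (hsmul : ∀ t : ℝ, 0 < t → ∀ a ∈ C, t • a ∈ C) {F : (σ → ℝ) → ℝ}
    (hFhom : ∀ t : ℝ, 0 < t → ∀ a, F (t • a) = t * F a) (hFadd : ∀ a b, F a + F b ≤ F (a + b))
    {ν : ℝ} (hν : 0 < ν) (hmax : ∀ b ∈ C, ∑ i, b i ^ 2 = 1 → F b ≤ ν) {a a' : σ → ℝ}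
    (ha : a ∈ C) (ha' : a' ∈ C) (h1 : ∑ i, a i ^ 2 = 1) (h1' : ∑ i, a' i ^ 2 = 1)
    (hFa : F a = ν) (hFa' : F a' = ν) : a = a' := by
  by_contra hne
  set m : σ → ℝ := (1 / 2 : ℝ) • (a + a') with hm
  have hmC : m ∈ C := hsmul _ (by norm_num) _ (hadd a ha a' ha')
  have hFm : ν ≤ F m := by
    rw [hm, hFhom _ (by norm_num)]
    have := hFadd a a'
    rw [hFa, hFa'] at this
    linarith
  have hlt : ∑ i, m i ^ 2 < 1 := sum_sq_midpoint_lt_one h1 h1' hne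
  -- `m ≠ 0`, so its norm is positive
  have hq_pos : 0 < ∑ i, m i ^ 2 := by
    rcases (Finset.sum_nonneg fun i (_ : i ∈ Finset.univ) => sq_nonneg (m i)).lt_or_eq with h | h
    · exact h
    · exfalso
      have hm0 : m = 0 := by
        funext i
        have := (Finset.sum_eq_zero_iff_of_nonneg fun j (_ : j ∈ Finset.univ) => sq_nonneg (m j)).mp
          h.symm i (Finset.mem_univ i)
        exact pow_eq_zero_iff (n := 2) (by norm_num) |>.mp this
      rw [hm0, eq_zero_of_posHom hFhom] at hFm
      exact absurd hFm (not_le.mpr hν)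
  -- rescale `m` to the sphere
  set r : ℝ := Real.sqrt (∑ i, m i ^ 2) with hr
  have hr_pos : 0 < r := Real.sqrt_pos.mpr hq_pos
  have hr_lt : r < 1 := by
    rw [hr, Real.sqrt_lt' one_pos, one_pow]
    exact hlt
  have hr_sq : r ^ 2 = ∑ i, m i ^ 2 := Real.sq_sqrt hq_pos.le
  set m' : σ → ℝ := r⁻¹ • m with hm'
  have hm'C : m' ∈ C := hsmul _ (inv_pos.mpr hr_pos) _ hmC
  have hm'1 : ∑ i, m' i ^ 2 = 1 := by
    have : ∑ i, m' i ^ 2 = r⁻¹ ^ 2 * ∑ i, m i ^ 2 := by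
      rw [Finset.mul_sum]
      refine Finset.sum_congr rfl fun i _ => ?_
      simp only [hm', Pi.smul_apply, smul_eq_mul]
      ring
    rw [this, ← hr_sq, inv_pow, inv_mul_cancel₀ (pow_ne_zero 2 hr_pos.ne')]
  have hFm' : F m' = r⁻¹ * F m := by rw [hm', hFhom _ (inv_pos.mpr hr_pos)]
  have hbig : ν < F m' := by
    rw [hFm']
    have hFm_pos : 0 < F m := lt_of_lt_of_le hν hFm
    have hinv : 1 < r⁻¹ := one_lt_inv_iff₀.mpr ⟨hr_pos, hr_lt⟩
    calc ν ≤ F m := hFm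
      _ = 1 * F m := (one_mul _).symm
      _ < r⁻¹ * F m := mul_lt_mul_of_pos_right hinv hFm_pos
  exact absurd (hmax m' hm'C hm'1) (not_le.mpr hbig)

omit [Fintype σ] in
/-- **The minimum of finitely many linear forms is superadditive.**
[cite: Kempf1978, §2 (the function `m(x, λ)` is a minimum of linear functions of `λ`)] -/
theorem inf'_linear_superadditive {ι : Type*} (s : Finset ι) (hs : s.Nonempty)
    (ℓ : ι → (σ → ℝ) →ₗ[ℝ] ℝ) (a b : σ → ℝ) :
    s.inf' hs (fun j => ℓ j a) + s.inf' hs (fun j => ℓ j b) ≤ s.inf' hs (fun j => ℓ j (a + b)) := by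
  rw [Finset.le_inf'_iff]
  intro j hj
  rw [map_add]
  exact add_le_add (Finset.inf'_le _ hj) (Finset.inf'_le _ hj)

omit [Fintype σ] in
/-- **The minimum of finitely many linear forms is positively homogeneous.**
[cite: Kempf1978, §2 (the function `m(x, λ)` is a minimum of linear functions of `λ`)] -/
theorem inf'_linear_posHom {ι : Type*} (s : Finset ι) (hs : s.Nonempty)
    (ℓ : ι → (σ → ℝ) →ₗ[ℝ] ℝ) {t : ℝ} (ht : 0 ≤ t) (a : σ → ℝ) :
    s.inf' hs (fun j => ℓ j (t • a)) = t * s.inf' hs (fun j => ℓ j a) := by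
  simp_rw [map_smul, smul_eq_mul]
  refine le_antisymm ?_ ?_
  · obtain ⟨j, hj, hmin⟩ := Finset.exists_mem_eq_inf' hs (fun j => ℓ j a)
    rw [hmin]
    exact Finset.inf'_le _ hj
  · rw [Finset.le_inf'_iff]
    intro j hj
    exact mul_le_mul_of_nonneg_left (Finset.inf'_le _ hj) ht

/-- **The minimum of finitely many linear forms is continuous.**
[cite: Kempf1978, §2 (the function `m(x, λ)` is a minimum of linear functions of `λ`)] -/
theorem continuous_inf'_linear {ι : Type*} (s : Finset ι) (hs : s.Nonempty)
    (ℓ : ι → (σ → ℝ) →ₗ[ℝ] ℝ) :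
    Continuous fun a : σ → ℝ => s.inf' hs (fun j => ℓ j a) := by
  refine Continuous.finset_inf'_apply hs fun j _ => ?_
  exact (ℓ j).continuous_of_finiteDimensional

end Literature.Analysis.Convex
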